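import Literature.NumberTheory.ConnesMoscovici2022.UVProlateQuotientBasisVectors
import HarnessLib

/-!
# Connes–Moscovici 2022, Lemma 1.5 (corrected statement): DISCHARGE

LINE 1 — FRAMING. RH-FREE corpus literature (cell rh-crit, C1 Connes–Consani/Moscovici corpus,
row O2 `UVProlateSpectrum`; no leaf / binder role).  bears_on: LADDER-RH W-C/W-P.  WHAT THIS IS
NOT: any claim about `ζ` or RH; nothing here bears on the truth of RH.  Theorems only.

`CM22_lemma_1_5_corr_holds`: the eight printed vectors `{α±, β±, α̂±, β̂±}` lie in `dom W_max` and
form a basis of `dom W_max / dom W_min` — assembled from the membership theorems and the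
`Ω`-matrix entries of `UVProlateQuotientBasisVectors.lean` (seat cc-t8), the `Ω`-matrix criterion and
von Neumann dimension count of `UVProlateVonNeumann.lean` (seat cc-t11:
`CM22_lemma_1_5_corr_of_omegaMatrix`, with `CM22_lemma_1_1_holds`), and the `𝔽`-invariance of
`dom W_max` and of `Ω` of `UVProlateMaxDomainFourier.lean` (seat cc-t10).  The printed proof:
"the matrix representation of `Ω` with respect to the given quadruplet has a single nonzero entry
in each row and column" — here: the only non-zero entries are `Ω(α₊,β₊) = Ω(α̂₊,β̂₊) = −4λi`,
`Ω(α₋,β₋) = Ω(α̂₋,β̂₋) = −4λ³i` and their Hermitian mirrors, so the kernel of the `8 × 8` matrix is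
trivial by reading off one coordinate per row.

## References

* [ConnesMoscovici2022] A. Connes, H. Moscovici, *The UV prolate spectrum matches the zeros of
  zeta*, PNAS 119 (2022) = arXiv:2112.05500, Lemma 1.5 (= arXiv Lemma 2.5) and its proof
  (held text `paper-arxiv-2112.05500`, chunk p0005:L84–L104).
-/

noncomputable section

open Complex Set MeasureTheory Filter Topology
open scoped Real Topology InnerProductSpace

namespace Literature.NumberTheory.ConnesMoscovici2022

/-- RH-FREE (PROVED). **Lemma 1.5 (corrected statement) holds**: "The quadruplet
`{α±, β±, α̂±, β̂±}` forms a basis of `ℰ±`", `ℰ = dom(W_max)/dom(W_min)`.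
[cite: ConnesMoscovici2022, Lemma 1.5 (= arXiv:2112.05500 Lemma 2.5, chunk p0005:L84–L104)] -/
theorem CM22_lemma_1_5_corr_holds : CM22_lemma_1_5_corr := by
  refine CM22_lemma_1_5_corr_of_omegaMatrix ?_
  intro lam hlam α hαU heven hlog hsupp αp αm βp βm hαp hαm hβp hβm v
  have hv : ∀ i, v i ∈ (prolateMax lam).domain :=
    CM22_lemma_1_5_corr_mem_eight hlam hαU heven hlog hsupp αp αm βp βm hαp hαm hβp hβm
  refine ⟨hv, fun c hc ↦ ?_⟩
  have hv0 : αp ∈ (prolateMax lam).domain := hv 0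
  have hv1 : αm ∈ (prolateMax lam).domain := hv 1
  have hv2 : βp ∈ (prolateMax lam).domain := hv 2
  have hv3 : βm ∈ (prolateMax lam).domain := hv 3
  have hv4 : fourierL2 αp ∈ (prolateMax lam).domain := hv 4
  have hv5 : fourierL2 αm ∈ (prolateMax lam).domain := hv 5
  have hv6 : fourierL2 βp ∈ (prolateMax lam).domain := hv 6
  have hv7 : fourierL2 βm ∈ (prolateMax lam).domain := hv 7
  -- smooth representatives of the four Fourier images
  have hga := memLp_alpha hlam hαU heven hlog hsupp
  have hgm := memLp_alphaMinus hlam hαU heven hlog hsupp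
  have hgbp : MemLp (fun x ↦ (Icc (-lam) lam).indicator (fun _ : ℝ ↦ (1 : ℂ)) x) 2 volume :=
    memLp_indicator_mul_of_continuous continuous_const lam
  have hgbm : MemLp (fun x ↦ (Icc (-lam) lam).indicator (fun x : ℝ ↦ (x : ℂ)) x) 2 volume :=
    memLp_indicator_mul_of_continuous Complex.continuous_ofReal lam
  have eαp : αp = hga.toLp _ := Lp.ext (hαp.trans hga.coeFn_toLp.symm)
  have eαm : αm = hgm.toLp _ := Lp.ext (hαm.trans hgm.coeFn_toLp.symm)
  have eβp : βp = hgbp.toLp _ := Lp.ext (hβp.trans hgbp.coeFn_toLp.symm)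
  have eβm : βm = hgbm.toLp _ := Lp.ext (hβm.trans hgbm.coeFn_toLp.symm)
  have hRα : ∀ x, 3 / 2 * lam ≤ |x| → (α x : ℂ) = 0 := fun x hx ↦ by
    simp [alpha_eq_zero_of_le_abs heven hsupp hx]
  have hRαm : ∀ x : ℝ, 3 / 2 * lam ≤ |x| → (x : ℂ) * (α x : ℂ) = 0 := fun x hx ↦ by
    simp [alpha_eq_zero_of_le_abs heven hsupp hx]
  have hRβ : ∀ {f : ℝ → ℂ} (x : ℝ), lam + 1 ≤ |x| → (Icc (-lam) lam).indicator f x = 0 := by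
    intro f x hx
    rw [indicator_of_notMem]
    intro hm
    have : |x| ≤ lam := abs_le.2 ⟨hm.1, hm.2⟩
    linarith
  obtain ⟨h4, hh4, hr4⟩ := exists_contDiff_repr_fourierL2 hga hRα
  obtain ⟨h5, hh5, hr5⟩ := exists_contDiff_repr_fourierL2 hgm hRαm
  obtain ⟨h6, hh6, hr6⟩ := exists_contDiff_repr_fourierL2 hgbp (fun x hx ↦ hRβ x hx)
  obtain ⟨h7, hh7, hr7⟩ := exists_contDiff_repr_fourierL2 hgbm (fun x hx ↦ hRβ x hx)
  rw [← eαp] at hr4; rw [← eαm] at hr5; rw [← eβp] at hr6; rw [← eβm] at hr7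
  -- the entries: formula × formula
  have E02 : omegaForm lam ⟨αp, hv0⟩ ⟨βp, hv2⟩ = -(4 * lam) * I :=
    omegaForm_alphaPlus_betaPlus hlam hαU heven hlog hsupp αp βp hαp hβp hv0 hv2
  have E13 : omegaForm lam ⟨αm, hv1⟩ ⟨βm, hv3⟩ = -(4 * lam ^ 3) * I :=
    omegaForm_alphaMinus_betaMinus hlam hαU heven hlog hsupp αm βm hαm hβm hv1 hv3
  have E03 : omegaForm lam ⟨αp, hv0⟩ ⟨βm, hv3⟩ = 0 :=
    omegaForm_alphaPlus_betaMinus hlam hαU heven hlog hsupp αp βm hαp hβm hv0 hv3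
  have E12 : omegaForm lam ⟨αm, hv1⟩ ⟨βp, hv2⟩ = 0 :=
    omegaForm_alphaMinus_betaPlus hlam hαU heven hlog hsupp αm βp hαm hβp hv1 hv2
  have E00 : omegaForm lam ⟨αp, hv0⟩ ⟨αp, hv0⟩ = 0 :=
    omegaForm_alphaPlus_alphaPlus hlam hαU heven hlog hsupp αp hαp hv0
  have E11 : omegaForm lam ⟨αm, hv1⟩ ⟨αm, hv1⟩ = 0 :=
    omegaForm_alphaMinus_alphaMinus hlam hαU heven hlog hsupp αm hαm hv1
  have E01 : omegaForm lam ⟨αp, hv0⟩ ⟨αm, hv1⟩ = 0 :=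
    omegaForm_alphaPlus_alphaMinus hlam hαU heven hlog hsupp αp αm hαp hαm hv0 hv1
  have E10 : omegaForm lam ⟨αm, hv1⟩ ⟨αp, hv0⟩ = 0 :=
    omegaForm_alphaMinus_alphaPlus hlam hαU heven hlog hsupp αp αm hαp hαm hv0 hv1
  have EB : ∀ {β₁ β₂ : L2R} {f₁ f₂ : ℝ → ℂ} (hf₁ : ContDiff ℝ 2 f₁) (hf₂ : ContDiff ℝ 2 f₂)
      (e₁ : (β₁ : ℝ → ℂ) =ᵐ[volume] (Icc (-lam) lam).indicator f₁)
      (e₂ : (β₂ : ℝ → ℂ) =ᵐ[volume] (Icc (-lam) lam).indicator f₂)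
      (h₁ : β₁ ∈ (prolateMax lam).domain) (h₂ : β₂ ∈ (prolateMax lam).domain),
      omegaForm lam ⟨β₁, h₁⟩ ⟨β₂, h₂⟩ = 0 := fun hf₁ hf₂ e₁ e₂ h₁ h₂ ↦
    omegaForm_indicator_indicator hlam hf₁ hf₂ _ _ e₁ e₂ h₁ h₂
  have hf1 : ContDiff ℝ 2 (fun _ : ℝ ↦ (1 : ℂ)) := contDiff_const
  have hfx : ContDiff ℝ 2 (fun x : ℝ ↦ (x : ℂ)) := Complex.ofRealCLM.contDiff
  have E22 := EB hf1 hf1 hβp hβp hv2 hv2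
  have E23 := EB hf1 hfx hβp hβm hv2 hv3
  have E32 := EB hfx hf1 hβm hβp hv3 hv2
  have E33 := EB hfx hfx hβm hβm hv3 hv3
  have E20 : omegaForm lam ⟨βp, hv2⟩ ⟨αp, hv0⟩ = (starRingEnd ℂ) (-(4 * lam) * I) := by
    rw [omegaForm_swap, E02]
  have E31 : omegaForm lam ⟨βm, hv3⟩ ⟨αm, hv1⟩ = (starRingEnd ℂ) (-(4 * lam ^ 3) * I) := by
    rw [omegaForm_swap, E13]
  have E30 : omegaForm lam ⟨βm, hv3⟩ ⟨αp, hv0⟩ = 0 := by rw [omegaForm_swap, E03, map_zero]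
  have E21 : omegaForm lam ⟨βp, hv2⟩ ⟨αm, hv1⟩ = 0 := by rw [omegaForm_swap, E12, map_zero]
  -- formula × Fourier (all zero) : row i ∈ 0..3 against column 4+k
  have MA : ∀ (η : L2R) (hη : η ∈ (prolateMax lam).domain) {h : ℝ → ℂ}, ContDiff ℝ 2 h →
      ((η : ℝ → ℂ) =ᵐ[volume] h) → omegaForm lam ⟨αp, hv0⟩ ⟨η, hη⟩ = 0 := fun η hη h hh hηh ↦
    omegaForm_alphaPlus_smooth hlam hαU heven hlog hsupp αp hαp hv0 η hη hh hηh
  have MM : ∀ (η : L2R) (hη : η ∈ (prolateMax lam).domain) {h : ℝ → ℂ}, ContDiff ℝ 2 h →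
      ((η : ℝ → ℂ) =ᵐ[volume] h) → omegaForm lam ⟨αm, hv1⟩ ⟨η, hη⟩ = 0 := fun η hη h hh hηh ↦
    omegaForm_alphaMinus_smooth hlam hαU heven hlog hsupp αm hαm hv1 η hη hh hηh
  have MBp : ∀ (η : L2R) (hη : η ∈ (prolateMax lam).domain) {h : ℝ → ℂ}, ContDiff ℝ 2 h →
      ((η : ℝ → ℂ) =ᵐ[volume] h) → omegaForm lam ⟨βp, hv2⟩ ⟨η, hη⟩ = 0 := fun η hη h hh hηh ↦
    omegaForm_indicator_smooth hlam hf1 βp hβp hv2 η hη hh hηh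
  have MBm : ∀ (η : L2R) (hη : η ∈ (prolateMax lam).domain) {h : ℝ → ℂ}, ContDiff ℝ 2 h →
      ((η : ℝ → ℂ) =ᵐ[volume] h) → omegaForm lam ⟨βm, hv3⟩ ⟨η, hη⟩ = 0 := fun η hη h hh hηh ↦
    omegaForm_indicator_smooth hlam hfx βm hβm hv3 η hη hh hηh
  have M04 := MA _ hv4 hh4 hr4; have M05 := MA _ hv5 hh5 hr5
  have M06 := MA _ hv6 hh6 hr6; have M07 := MA _ hv7 hh7 hr7
  have M14 := MM _ hv4 hh4 hr4; have M15 := MM _ hv5 hh5 hr5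
  have M16 := MM _ hv6 hh6 hr6; have M17 := MM _ hv7 hh7 hr7
  have M24 := MBp _ hv4 hh4 hr4; have M25 := MBp _ hv5 hh5 hr5
  have M26 := MBp _ hv6 hh6 hr6; have M27 := MBp _ hv7 hh7 hr7
  have M34 := MBm _ hv4 hh4 hr4; have M35 := MBm _ hv5 hh5 hr5
  have M36 := MBm _ hv6 hh6 hr6; have M37 := MBm _ hv7 hh7 hr7
  -- Fourier × formula (all zero, by Hermitian symmetry)
  have SW : ∀ (ξ η : (prolateMax lam).domain), omegaForm lam ξ η = 0 → omegaForm lam η ξ = 0 :=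
    fun ξ η h0 ↦ by rw [omegaForm_swap, h0, map_zero]
  have M40 := SW _ _ M04; have M50 := SW _ _ M05; have M60 := SW _ _ M06; have M70 := SW _ _ M07
  have M41 := SW _ _ M14; have M51 := SW _ _ M15; have M61 := SW _ _ M16; have M71 := SW _ _ M17
  have M42 := SW _ _ M24; have M52 := SW _ _ M25; have M62 := SW _ _ M26; have M72 := SW _ _ M27
  have M43 := SW _ _ M34; have M53 := SW _ _ M35; have M63 := SW _ _ M36; have M73 := SW _ _ M37
  -- Fourier × Fourier = formula × formula
  have FF : ∀ (ξ η : (prolateMax lam).domain) (h1 : fourierL2 (ξ : L2R) ∈ (prolateMax lam).domain)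
      (h2 : fourierL2 (η : L2R) ∈ (prolateMax lam).domain),
      omegaForm lam ⟨fourierL2 (ξ : L2R), h1⟩ ⟨fourierL2 (η : L2R), h2⟩ = omegaForm lam ξ η :=
    fun ξ η h1 h2 ↦ omegaForm_fourierL2 lam ξ η
  have F44 := FF ⟨αp, hv0⟩ ⟨αp, hv0⟩ hv4 hv4; have F45 := FF ⟨αp, hv0⟩ ⟨αm, hv1⟩ hv4 hv5
  have F46 := FF ⟨αp, hv0⟩ ⟨βp, hv2⟩ hv4 hv6; have F47 := FF ⟨αp, hv0⟩ ⟨βm, hv3⟩ hv4 hv7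
  have F54 := FF ⟨αm, hv1⟩ ⟨αp, hv0⟩ hv5 hv4; have F55 := FF ⟨αm, hv1⟩ ⟨αm, hv1⟩ hv5 hv5
  have F56 := FF ⟨αm, hv1⟩ ⟨βp, hv2⟩ hv5 hv6; have F57 := FF ⟨αm, hv1⟩ ⟨βm, hv3⟩ hv5 hv7
  have F64 := FF ⟨βp, hv2⟩ ⟨αp, hv0⟩ hv6 hv4; have F65 := FF ⟨βp, hv2⟩ ⟨αm, hv1⟩ hv6 hv5
  have F66 := FF ⟨βp, hv2⟩ ⟨βp, hv2⟩ hv6 hv6; have F67 := FF ⟨βp, hv2⟩ ⟨βm, hv3⟩ hv6 hv7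
  have F74 := FF ⟨βm, hv3⟩ ⟨αp, hv0⟩ hv7 hv4; have F75 := FF ⟨βm, hv3⟩ ⟨αm, hv1⟩ hv7 hv5
  have F76 := FF ⟨βm, hv3⟩ ⟨βp, hv2⟩ hv7 hv6; have F77 := FF ⟨βm, hv3⟩ ⟨βm, hv3⟩ hv7 hv7
  -- non-vanishing of the two pivots
  have hlam0 : (lam : ℂ) ≠ 0 := by exact_mod_cast hlam.ne'
  have hp1 : (starRingEnd ℂ) (-(4 * (lam : ℂ)) * I) ≠ 0 := by
    rw [map_ne_zero_iff _ (RingHom.injective _)]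
    exact mul_ne_zero (neg_ne_zero.2 (mul_ne_zero (by norm_num) hlam0)) I_ne_zero
  have hp2 : (starRingEnd ℂ) (-(4 * (lam : ℂ) ^ 3) * I) ≠ 0 := by
    rw [map_ne_zero_iff _ (RingHom.injective _)]
    exact mul_ne_zero (neg_ne_zero.2 (mul_ne_zero (by norm_num) (pow_ne_zero 3 hlam0))) I_ne_zero
  have hp3 : (-(4 * (lam : ℂ)) * I) ≠ 0 :=
    mul_ne_zero (neg_ne_zero.2 (mul_ne_zero (by norm_num) hlam0)) I_ne_zero
  have hp4 : (-(4 * (lam : ℂ) ^ 3) * I) ≠ 0 :=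
    mul_ne_zero (neg_ne_zero.2 (mul_ne_zero (by norm_num) (pow_ne_zero 3 hlam0))) I_ne_zero
  -- the rows
  have row : ∀ j, omegaForm lam ⟨v j, hv j⟩ ⟨v 0, hv 0⟩ * c 0 +
      omegaForm lam ⟨v j, hv j⟩ ⟨v 1, hv 1⟩ * c 1 + omegaForm lam ⟨v j, hv j⟩ ⟨v 2, hv 2⟩ * c 2 +
      omegaForm lam ⟨v j, hv j⟩ ⟨v 3, hv 3⟩ * c 3 + omegaForm lam ⟨v j, hv j⟩ ⟨v 4, hv 4⟩ * c 4 +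
      omegaForm lam ⟨v j, hv j⟩ ⟨v 5, hv 5⟩ * c 5 + omegaForm lam ⟨v j, hv j⟩ ⟨v 6, hv 6⟩ * c 6 +
      omegaForm lam ⟨v j, hv j⟩ ⟨v 7, hv 7⟩ * c 7 = 0 := by
    intro j
    have := hc j
    simpa [Fin.sum_univ_succ, add_assoc] using this
  have r2 := row 2; have r3 := row 3; have r0 := row 0; have r1 := row 1
  have r6 := row 6; have r7 := row 7; have r4 := row 4; have r5 := row 5
  -- unfold the vector entries
  change omegaForm lam ⟨βp, hv2⟩ ⟨αp, hv0⟩ * c 0 + omegaForm lam ⟨βp, hv2⟩ ⟨αm, hv1⟩ * c 1 +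
    omegaForm lam ⟨βp, hv2⟩ ⟨βp, hv2⟩ * c 2 + omegaForm lam ⟨βp, hv2⟩ ⟨βm, hv3⟩ * c 3 +
    omegaForm lam ⟨βp, hv2⟩ ⟨fourierL2 αp, hv4⟩ * c 4 +
    omegaForm lam ⟨βp, hv2⟩ ⟨fourierL2 αm, hv5⟩ * c 5 +
    omegaForm lam ⟨βp, hv2⟩ ⟨fourierL2 βp, hv6⟩ * c 6 +
    omegaForm lam ⟨βp, hv2⟩ ⟨fourierL2 βm, hv7⟩ * c 7 = 0 at r2
  rw [E20, E21, E22, E23, M24, M25, M26, M27] at r2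
  have c0 : c 0 = 0 := (show lam = 0 ∨ c 0 = 0 by simpa using r2).resolve_left hlam.ne'
  change omegaForm lam ⟨βm, hv3⟩ ⟨αp, hv0⟩ * c 0 + omegaForm lam ⟨βm, hv3⟩ ⟨αm, hv1⟩ * c 1 +
    omegaForm lam ⟨βm, hv3⟩ ⟨βp, hv2⟩ * c 2 + omegaForm lam ⟨βm, hv3⟩ ⟨βm, hv3⟩ * c 3 +
    omegaForm lam ⟨βm, hv3⟩ ⟨fourierL2 αp, hv4⟩ * c 4 +
    omegaForm lam ⟨βm, hv3⟩ ⟨fourierL2 αm, hv5⟩ * c 5 +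
    omegaForm lam ⟨βm, hv3⟩ ⟨fourierL2 βp, hv6⟩ * c 6 +
    omegaForm lam ⟨βm, hv3⟩ ⟨fourierL2 βm, hv7⟩ * c 7 = 0 at r3
  rw [E30, E31, E32, E33, M34, M35, M36, M37] at r3
  have c1 : c 1 = 0 := (show lam = 0 ∨ c 1 = 0 by simpa using r3).resolve_left hlam.ne'
  change omegaForm lam ⟨αp, hv0⟩ ⟨αp, hv0⟩ * c 0 + omegaForm lam ⟨αp, hv0⟩ ⟨αm, hv1⟩ * c 1 +
    omegaForm lam ⟨αp, hv0⟩ ⟨βp, hv2⟩ * c 2 + omegaForm lam ⟨αp, hv0⟩ ⟨βm, hv3⟩ * c 3 +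
    omegaForm lam ⟨αp, hv0⟩ ⟨fourierL2 αp, hv4⟩ * c 4 +
    omegaForm lam ⟨αp, hv0⟩ ⟨fourierL2 αm, hv5⟩ * c 5 +
    omegaForm lam ⟨αp, hv0⟩ ⟨fourierL2 βp, hv6⟩ * c 6 +
    omegaForm lam ⟨αp, hv0⟩ ⟨fourierL2 βm, hv7⟩ * c 7 = 0 at r0
  rw [E00, E01, E02, E03, M04, M05, M06, M07] at r0
  have c2 : c 2 = 0 := (show lam = 0 ∨ c 2 = 0 by simpa using r0).resolve_left hlam.ne'
  change omegaForm lam ⟨αm, hv1⟩ ⟨αp, hv0⟩ * c 0 + omegaForm lam ⟨αm, hv1⟩ ⟨αm, hv1⟩ * c 1 +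
    omegaForm lam ⟨αm, hv1⟩ ⟨βp, hv2⟩ * c 2 + omegaForm lam ⟨αm, hv1⟩ ⟨βm, hv3⟩ * c 3 +
    omegaForm lam ⟨αm, hv1⟩ ⟨fourierL2 αp, hv4⟩ * c 4 +
    omegaForm lam ⟨αm, hv1⟩ ⟨fourierL2 αm, hv5⟩ * c 5 +
    omegaForm lam ⟨αm, hv1⟩ ⟨fourierL2 βp, hv6⟩ * c 6 +
    omegaForm lam ⟨αm, hv1⟩ ⟨fourierL2 βm, hv7⟩ * c 7 = 0 at r1
  rw [E10, E11, E12, E13, M14, M15, M16, M17] at r1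
  have c3 : c 3 = 0 := (show lam = 0 ∨ c 3 = 0 by simpa using r1).resolve_left hlam.ne'
  change omegaForm lam ⟨fourierL2 βp, hv6⟩ ⟨αp, hv0⟩ * c 0 +
    omegaForm lam ⟨fourierL2 βp, hv6⟩ ⟨αm, hv1⟩ * c 1 +
    omegaForm lam ⟨fourierL2 βp, hv6⟩ ⟨βp, hv2⟩ * c 2 +
    omegaForm lam ⟨fourierL2 βp, hv6⟩ ⟨βm, hv3⟩ * c 3 +
    omegaForm lam ⟨fourierL2 βp, hv6⟩ ⟨fourierL2 αp, hv4⟩ * c 4 +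
    omegaForm lam ⟨fourierL2 βp, hv6⟩ ⟨fourierL2 αm, hv5⟩ * c 5 +
    omegaForm lam ⟨fourierL2 βp, hv6⟩ ⟨fourierL2 βp, hv6⟩ * c 6 +
    omegaForm lam ⟨fourierL2 βp, hv6⟩ ⟨fourierL2 βm, hv7⟩ * c 7 = 0 at r6
  rw [M60, M61, M62, M63, F64, F65, F66, F67, E20, E21, E22, E23] at r6
  have c4 : c 4 = 0 := (show lam = 0 ∨ c 4 = 0 by simpa using r6).resolve_left hlam.ne'
  change omegaForm lam ⟨fourierL2 βm, hv7⟩ ⟨αp, hv0⟩ * c 0 +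
    omegaForm lam ⟨fourierL2 βm, hv7⟩ ⟨αm, hv1⟩ * c 1 +
    omegaForm lam ⟨fourierL2 βm, hv7⟩ ⟨βp, hv2⟩ * c 2 +
    omegaForm lam ⟨fourierL2 βm, hv7⟩ ⟨βm, hv3⟩ * c 3 +
    omegaForm lam ⟨fourierL2 βm, hv7⟩ ⟨fourierL2 αp, hv4⟩ * c 4 +
    omegaForm lam ⟨fourierL2 βm, hv7⟩ ⟨fourierL2 αm, hv5⟩ * c 5 +
    omegaForm lam ⟨fourierL2 βm, hv7⟩ ⟨fourierL2 βp, hv6⟩ * c 6 +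
    omegaForm lam ⟨fourierL2 βm, hv7⟩ ⟨fourierL2 βm, hv7⟩ * c 7 = 0 at r7
  rw [M70, M71, M72, M73, F74, F75, F76, F77, E30, E31, E32, E33] at r7
  have c5 : c 5 = 0 := (show lam = 0 ∨ c 5 = 0 by simpa using r7).resolve_left hlam.ne'
  change omegaForm lam ⟨fourierL2 αp, hv4⟩ ⟨αp, hv0⟩ * c 0 +
    omegaForm lam ⟨fourierL2 αp, hv4⟩ ⟨αm, hv1⟩ * c 1 +
    omegaForm lam ⟨fourierL2 αp, hv4⟩ ⟨βp, hv2⟩ * c 2 +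
    omegaForm lam ⟨fourierL2 αp, hv4⟩ ⟨βm, hv3⟩ * c 3 +
    omegaForm lam ⟨fourierL2 αp, hv4⟩ ⟨fourierL2 αp, hv4⟩ * c 4 +
    omegaForm lam ⟨fourierL2 αp, hv4⟩ ⟨fourierL2 αm, hv5⟩ * c 5 +
    omegaForm lam ⟨fourierL2 αp, hv4⟩ ⟨fourierL2 βp, hv6⟩ * c 6 +
    omegaForm lam ⟨fourierL2 αp, hv4⟩ ⟨fourierL2 βm, hv7⟩ * c 7 = 0 at r4
  rw [M40, M41, M42, M43, F44, F45, F46, F47, E00, E01, E02, E03] at r4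
  have c6 : c 6 = 0 := (show lam = 0 ∨ c 6 = 0 by simpa using r4).resolve_left hlam.ne'
  change omegaForm lam ⟨fourierL2 αm, hv5⟩ ⟨αp, hv0⟩ * c 0 +
    omegaForm lam ⟨fourierL2 αm, hv5⟩ ⟨αm, hv1⟩ * c 1 +
    omegaForm lam ⟨fourierL2 αm, hv5⟩ ⟨βp, hv2⟩ * c 2 +
    omegaForm lam ⟨fourierL2 αm, hv5⟩ ⟨βm, hv3⟩ * c 3 +
    omegaForm lam ⟨fourierL2 αm, hv5⟩ ⟨fourierL2 αp, hv4⟩ * c 4 +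
    omegaForm lam ⟨fourierL2 αm, hv5⟩ ⟨fourierL2 αm, hv5⟩ * c 5 +
    omegaForm lam ⟨fourierL2 αm, hv5⟩ ⟨fourierL2 βp, hv6⟩ * c 6 +
    omegaForm lam ⟨fourierL2 αm, hv5⟩ ⟨fourierL2 βm, hv7⟩ * c 7 = 0 at r5
  rw [M50, M51, M52, M53, F54, F55, F56, F57, E10, E11, E12, E13] at r5
  have c7 : c 7 = 0 := (show lam = 0 ∨ c 7 = 0 by simpa using r5).resolve_left hlam.ne'
  funext i
  fin_cases i
  all_goals simp only [Pi.zero_apply]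
  all_goals first
    | exact c0 | exact c1 | exact c2 | exact c3 | exact c4 | exact c5 | exact c6 | exact c7

end Literature.NumberTheory.ConnesMoscovici2022

end
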